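import Summits.QuantumFields.YangMills.Theses.SlackWindow
import Summits.QuantumFields.YangMills.Theses.SquareRootCeilings
import Summits.QuantumFields.YangMills.Theorems.SquareRootCeilingsMirrorDominationRPCS
import HarnessLib

/-!
# Route `SlackWindow`: the slack binder of `SlackMirrorCeiling` is vacuous as typed

`SlackMirrorCeiling → SquareRootCeilings.AxisMirrorCeiling` (stmt-QuantumFields-23500 ⇒ stmt-QuantumFields-26791).
Together with the landed converse `SlackWindow.slackMirrorCeiling_of_axisMirror` (Theorems/SlackWindowSlackSqrtGlue.lean)
the two items are EQUIVALENT: the UV-slack factor `((R s)⁻¹)^σ` of the slack mirror ceiling carries no content, because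
(i) sub-onset-ness `∀ s' ∈ [2s, 1], ¬ Floors(s')` is upward-closed in the unit `s`, and (ii) the torus covariance does
not depend on `s`; so at fixed `R ≥ 1` one reads the slack ceiling at the larger sub-onset unit `s₁ := min(ℓ₄,1)/R`,
where `R s₁ = min(ℓ₄,1)` and the slack factor is the constant `min(ℓ₄,1)^{-σ}`.  The remaining difference between the
two items — time axis `e₀` only vs. every axis `e_k` — is removed by hypercubic invariance
(`MirrorDomination.cov_coordPerm`, Osterwalder–Seiler 1978 §2).

Consequence for the route (ym-idea-11 g10 self-audit): genuine slack must be demanded only at CARRIER units (sub-onset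
AND floors at `s`), which is where the calibration consumes it — see the LINE 3 items `CarrierSlackLarge*` of
`Theses/SlackWindow.lean`.  No summit / leaf / NT statement is proved here.
-/

namespace Summit.QuantumFields.YangMills.Theorems.SlackWindow.SlackVacuity

open Literature.MathematicalPhysics.QuantumFieldTheory Literature.MathematicalPhysics.QuantumLattice
open Summit.QuantumFields.YangMills.Cruxes.OSLegsFromFemtoAndGap.DlrCollarTransfer
open Summit.QuantumFields.YangMills.Theorems.OSLegsFromFemtoAndGap (permPlane permPlane_valid)

/-- The axis-`k` site `t·e_k`, read through the transposition `(0 k)`, is the time-axis site `t·e₀`. -/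
theorem axisSite_perm (k : Fin 4) (t : ℤ) :
    (fun i : Fin 4 => if (Equiv.swap (0 : Fin 4) k).symm i = k then t else 0) =
      fun i => if i = 0 then t else 0 := by
  funext i
  simp only [Equiv.symm_swap, Equiv.swap_apply_eq_iff, Equiv.swap_apply_right]

/-- **Vacuity of the slack binder.** `SlackMirrorCeiling` (slack, time axis) gives `AxisMirrorCeiling` (no slack,
every axis) with the constant `C · min(ℓ₄,1)^{-σ}` and the window `min(ℓ₄,1)`. -/
theorem axisMirrorCeiling_of_slackMirrorCeiling (h : Theses.SlackWindow.SlackMirrorCeiling) :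
    Theses.SquareRootCeilings.AxisMirrorCeiling := by
  intro G _ _ _ _ hG hSU
  letI : MeasurableSpace G := borel G
  haveI : BorelSpace G := ⟨rfl⟩
  intro r v f g h' Λ₅
  obtain ⟨ε₀, hε₀, h1⟩ := h G hG hSU r v f g h' Λ₅
  refine ⟨ε₀, hε₀, fun ε hε hεε hfl => ?_⟩
  obtain ⟨σ, C, ℓ₄, β₄, hℓ₄, hC, h2⟩ := h1 ε hε hεε hfl
  have hℓpos : 0 < min ℓ₄ 1 := lt_min hℓ₄ one_pos
  have hℓle : min ℓ₄ 1 ≤ ℓ₄ := min_le_left _ _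
  have hℓ1 : min ℓ₄ 1 ≤ 1 := min_le_right _ _
  refine ⟨C * ((min ℓ₄ 1)⁻¹) ^ σ, min ℓ₄ 1, β₄, hℓpos,
    mul_nonneg hC (pow_nonneg (inv_nonneg.mpr hℓpos.le) _), ?_⟩
  intro β hβ s hs hs1 hsub L q k R t hq hR hRs hRL ht htL
  have hR1 : (1 : ℝ) ≤ R := by exact_mod_cast hR
  have hRpos : (0 : ℝ) < R := lt_of_lt_of_le one_pos hR1
  -- the larger unit `s₁ := min(ℓ₄,1)/R ≥ s` is still sub-onset, and `R * s₁ = min(ℓ₄,1) ≤ ℓ₄`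
  have hs₁pos : 0 < min ℓ₄ 1 / R := div_pos hℓpos hRpos
  have hs₁le1 : min ℓ₄ 1 / R ≤ 1 := (div_le_one hRpos).mpr (le_trans hℓ1 hR1)
  have hss₁ : s ≤ min ℓ₄ 1 / R := by
    rw [le_div_iff₀ hRpos, mul_comm]; exact hRs
  have hRs₁ : (R : ℝ) * (min ℓ₄ 1 / R) = min ℓ₄ 1 := by field_simp
  have key := h2 β hβ (min ℓ₄ 1 / R) hs₁pos hs₁le1
    (fun s' h1' h2' => hsub s' (by linarith) h2') L (permPlane (Equiv.swap (0 : Fin 4) k) q) R t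
    (permPlane_valid _ hq) hR (le_of_eq hRs₁ |>.trans hℓle) hRL ht htL
  -- hypercubic invariance: rotate the axis `k` onto the time axis
  have hrot := MirrorDomination.cov_coordPerm G r β L (Equiv.swap (0 : Fin 4) k) q q
    (fun i => if i = k then (t : ℤ) else 0) (fun _ => 0)
  simp only [axisSite_perm] at hrot
  rw [← hrot]
  refine le_trans key (le_of_eq ?_)
  rw [hRs₁]
  ring

end Summit.QuantumFields.YangMills.Theorems.SlackWindow.SlackVacuity
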